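import Summits.ABC.StewartYu.PadicG3SatNSched
import Summits.ABC.StewartYu.PadicG3CountRb
import Summits.ABC.StewartYu.PadicG3ParNE
import HarnessLib

/-!
# Cell abc-stewartyu, WP-L.P(odd) (crux r3 `PadicCoreOddRat`, stmt-ABC-20503): the record's B1 COUNT in the frame's letters on `schedN 1`
# (from p1's `siegel_countN`; the START order `TordS (schedN 1) 0 0` enters through an explicit order hypothesis)

`Summits/ABC/StewartYu/PadicG3SatNCountB.lean` — cell `abc-stewartyu` (seat p2-g6; pack twin, B1; record owner p1 g11).  Proofs only; no definition,
no named fact.  Twin of `PadicG3CountR.startCountRV` for the `N`-record: the class factor `(p−1)·p^m = K`, the jet count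
`#(Icc(−X₀,X₀) ×ˢ tauSetR n j₀ T₀) ≤ (2X₀+1)·C(T₀−1+n, n)`, and `siegel_countN` give the hypothesis `hB1` of `ineqPackSat_schedN_one` /
`recordSupplyOddSatRD_of_package` PROVIDED the START order satisfies `(TordS (schedN 1) 0 0 − 1) + n ≤ (69/4)(n+1)·LgV` — NOTE for the record
owner: `TordS_zero_le` + `MordN_T0_le` only give `… ≤ (69/4)(n+1)LgV + 2(n+1)(ŜN − ŜG)`, so either `siegel_countN` is re-proved with that larger
order bound (kit slack (B1) ≥ 10^{1.28}) or the order hypothesis is discharged otherwise.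

* `sideS₂_schedN_one` (`sideS₂ (schedN 1) = sideV`), `startCountSatN` (explicit order hypothesis), `startCountSatN'` (hypothesis-free:
  p1's `siegel_countN'` + `TordS_zero_le`).

References: Yu. V. Nesterenko, LNM 1819 (2003) Prop 3.9 (3.48).
-/

noncomputable section

open Finset Real
open Literature.NumberTheory.Transcendental
open Literature.NumberTheory.Transcendental.CW77.Setup (Tau tauNorm)

namespace Summit.ABC.StewartYu

namespace G3Setup

variable {p : ℕ} [Fact p.Prime] (S : G3Setup p) (P : PadicG3ParN S.n)

/-- `sideS₂ (schedN 1) j = sideV j`. [folklore] -/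
theorem sideS₂_schedN_one (j : Fin S.n) : S.sideS₂ (P.schedN 1) j = P.sideV j := by
  rw [S.sideS₂_N_eq P 1]; exact S.sideS₂_schedVb_one P.toPadicG3Par j

/-- **(B1) of the saturated pack from `siegel_countN`**, given the START order bound `(TordS (schedN 1) 0 0 − 1) + n ≤ (69/4)(n+1)LgV`.
[cite: Nesterenko2003, Prop 3.9 (3.48); shape only] -/
theorem startCountSatN (hPp : P.p = p) (hK₀ : P.K₀ = p - 1) (hgK : P.g ^ S.n ≤ (P.K : ℝ)) {Nf : ℕ} (hNf : P.N = Nf)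
    (hM : (((S.TordS (P.schedN 1) 0 0 - 1 : ℕ) : ℝ)) + S.n ≤ (69 / 4) * (S.n + 1) * P.LgV) :
    2 * (Icc (-(S.NS (P.schedN 1) 0 0 : ℤ)) (S.NS (P.schedN 1) 0 0) ×ˢ tauSetR S.n S.j₀ (S.TordS (P.schedN 1) 0 0)).card *
        ((p - 1) * p ^ P.m) ≤ (P.L0N + 1) * (Nf * ∏ j, (2 * S.sideS₂ (P.schedN 1) j)) := by
  have h1 := S.card_eqsR_le (S.NS (P.schedN 1) 0 0) (S.TordS (P.schedN 1) 0 0)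
  have h2 := P.siegel_countN hgK (M' := S.TordS (P.schedN 1) 0 0 - 1) hM
  rw [P.class_factor_eq_K hPp hK₀, ← hNf]
  simp only [S.sideS₂_schedN_one P]
  rw [S.NS_N P 1, pow_zero, one_mul] at h1 ⊢
  calc 2 * (Icc (-(P.XsV 0 : ℤ)) (P.XsV 0) ×ˢ tauSetR S.n S.j₀ (S.TordS (P.schedN 1) 0 0)).card * P.K
      ≤ 2 * ((2 * P.XsV 0 + 1) * ((S.TordS (P.schedN 1) 0 0 - 1) + S.n).choose S.n) * P.K := by gcongr
    _ = 2 * (2 * P.XsV 0 + 1) * Nat.choose ((S.TordS (P.schedN 1) 0 0 - 1) + S.n) S.n * P.K := by ring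
    _ ≤ (P.L0N + 1) * P.N * ∏ j, (2 * P.sideV j) := h2
    _ = (P.L0N + 1) * (P.N * ∏ j, (2 * P.sideV j)) := by ring

/-- **(B1) of the saturated pack, hypothesis-free order** (p1's `siegel_countN'` at the natural START order `TordS (schedN 1) 0 0 − 1 ≤
MordN 0 0 + (n+1)(ŜN+1)`, `TordS_zero_le`): the `hB1` hypothesis of `ineqPackSat_schedN_one` / `recordSupplyOddSatRD_of_package`.
[cite: Nesterenko2003, Prop 3.9 (3.48); shape only] -/
theorem startCountSatN' (hPp : P.p = p) (hK₀ : P.K₀ = p - 1) (hNq : P.Nq = P.K) (hgK : P.g ^ S.n ≤ (P.K : ℝ)) {Nf : ℕ} (hNf : P.N = Nf) :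
    2 * (Icc (-(S.NS (P.schedN 1) 0 0 : ℤ)) (S.NS (P.schedN 1) 0 0) ×ˢ tauSetR S.n S.j₀ (S.TordS (P.schedN 1) 0 0)).card *
        ((p - 1) * p ^ P.m) ≤ (P.L0N + 1) * (Nf * ∏ j, (2 * S.sideS₂ (P.schedN 1) j)) := by
  have h1 := S.card_eqsR_le (S.NS (P.schedN 1) 0 0) (S.TordS (P.schedN 1) 0 0)
  have hM : S.TordS (P.schedN 1) 0 0 - 1 ≤ P.MordN 0 0 + (S.n + 1) * (P.SdN + 1) := by
    have h := S.TordS_zero_le (P.schedN 1)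
    rw [P.schedN_Mord, P.schedN_Sd] at h
    omega
  have h2 := P.siegel_countN' hNq hgK hM
  rw [P.class_factor_eq_K hPp hK₀, ← hNf]
  simp only [S.sideS₂_schedN_one P]
  rw [S.NS_N P 1, pow_zero, one_mul] at h1 ⊢
  calc 2 * (Icc (-(P.XsV 0 : ℤ)) (P.XsV 0) ×ˢ tauSetR S.n S.j₀ (S.TordS (P.schedN 1) 0 0)).card * P.K
      ≤ 2 * ((2 * P.XsV 0 + 1) * ((S.TordS (P.schedN 1) 0 0 - 1) + S.n).choose S.n) * P.K := by gcongr
    _ = 2 * (2 * P.XsV 0 + 1) * Nat.choose ((S.TordS (P.schedN 1) 0 0 - 1) + S.n) S.n * P.K := by ring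
    _ ≤ (P.L0N + 1) * P.N * ∏ j, (2 * P.sideV j) := h2
    _ = (P.L0N + 1) * (P.N * ∏ j, (2 * P.sideV j)) := by ring

end G3Setup

end Summit.ABC.StewartYu

end
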